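import Summits.CriticalPhenomena.PercolationContinuityZ3.Theorems.Transplant.SkelFrmFromBChoiceReadNums
import Summits.CriticalPhenomena.PercolationContinuityZ3.Theorems.Transplant.PlanarSkeletonFrmFromDefs
import Summits.CriticalPhenomena.PercolationContinuityZ3.Theorems.Transplant.SkelFrmFromBChoiceRootLanding
import Summits.CriticalPhenomena.PercolationContinuityZ3.Theorems.Transplant.SkelFrmBChoiceRootLanding
import Summits.CriticalPhenomena.PercolationContinuityZ3.Theorems.Transplant.SkelFrmFromBParamsCorrKGLen
import Summits.CriticalPhenomena.PercolationContinuityZ3.Theorems.Transplant.SkelFrmBParamsCorrKGLen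
import Summits.CriticalPhenomena.PercolationContinuityZ3.Theorems.Transplant.SkelPhiCorridorKGMono
import HarnessLib
import Summits.CriticalPhenomena.PercolationContinuityZ3.Theorems.Transplant.SkelFrmBChoiceRootRun
/-!
# U-WAVE PORT (RULING D-U, lead g21 2026-08-26; WAVE-U-MANIFEST v3.0 row «SkelFrmBChoiceRootRun» ↦ «SkelFrmFromBChoiceRootRun») of the tree module
# `Transplant/SkelFrmBChoiceRootRun` onto the carrier `PlanarSkeletonFrmFrom` (frames only, cylinders connected from width `ℓ₀` on)

ORIGINAL TITLE: N2 (frames-only node `SamePDropOfSkeletonFrm₁`, OPEN), (R) column — **THE ROOT'S OWN CORRIDOR RUN LENGTH `N_R` AND ITS ROWS**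

builds on p205010 (kernel theorem, internal audit signed; external expert review pending) — nothing in this file uses p205010; NOTHING is claimed about the
OPEN node U `SamePDropOfSkeletonFrmFrom₁` (nor U_s / the end state).  Lane `prim-bschramm`, seat `prim-hp-8 gen 53 (U-wave port pen, family P-hp8; tool of record = p3-g26 port_u.py)`; helper file
(`--supports stmt-CriticalPhenomena-4575 --as helper`).  PORT RULES r1–r4 of RULING D-U: declaration order and proof texts are those of the original,
byte-identical except (i) the carrier token `PlanarSkeletonFrm ↦ PlanarSkeletonFrmFrom` (binders, `namespace`/`end` lines, qualified names of twinned
declarations), (ii) carrier-FREE declarations of the original (φ-level `Skelφ…` blocks and namespace-only arithmetic residents) are NOT re-declared —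
this file imports the original and `export`s the twin-free residents (POLICY T / treatment (m1)); residents whose statement mentions a twinned
constant are copied, (iii) every carrier-binding declaration keeps its explicit binder `(Φ : PlanarSkeletonFrmFrom G)` in its own signature (r2).  Docstrings and citations are the original's.  Manifest row idx 128 (level 16; flags verbatim|DEF-ROW); filed by the hp-8 lineage under RULING M-11 (family P-hp8); extra twin imports ['SkelFrmFromBChoiceReadNums'] (hidden binder dependency through a carrier-free intermediate module).
-/

noncomputable section

open scoped Classical

namespace Summit.CriticalPhenomena.PercolationContinuityZ3.Theorems.Transplant

namespace PlanarSkeletonFrmFrom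

namespace NegB

open Literature.Probability.Percolation Literature.Probability.LatticeModels SimpleGraph
open SkelConc (Consts)
open Skelφ (shearUnit kgSL kgP kgΔ kgN KGRows kgFar kgX kgX₂ kgM₁ kgM₂ kgT₁ kgWm₂ kgWp₂ kgZ₀ kgZ₁)
open Neg

namespace KS

/-! ## §1 The root's steering target and run length -/

section Defs

variable (κ : Consts) {V : Type} [DecidableEq V] [Countable V] {G : SimpleGraph V} [G.LocallyFinite] (Φ : PlanarSkeletonFrmFrom G) (t : V) (p : unitInterval)
  (D : Skelφ.StepI.DataNS V) (mk g f qx Wx : ℕ)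

/-- **The root's steering target** `tgtR := kgTgt0 − X1` (the corridor frame's origin is the landing `c₁ = t + (X1, Y1)`). [this work] -/
def kgTgtR (κ : Consts) {V : Type} [DecidableEq V] [Countable V] {G : SimpleGraph V} [G.LocallyFinite] (Φ : PlanarSkeletonFrmFrom G) (t : V) (p : unitInterval) (D : Skelφ.StepI.DataNS V) (mk : ℕ) (g : ℕ) (f : ℕ) (qx : ℕ) : ℤ := (kgTgt0 κ Φ t p D g f mk) - (KS.X1 κ Φ t p D mk g f (kgq κ Φ t p D g f qx))

/-- **The root's run length** `N_R := kgN … tgtR` (largest run whose arrival far edge, measured from `c₁`, is `≤ tgtR`). [this work] -/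
def kgNR (κ : Consts) {V : Type} [DecidableEq V] [Countable V] {G : SimpleGraph V} [G.LocallyFinite] (Φ : PlanarSkeletonFrmFrom G) (t : V) (p : unitInterval) (D : Skelφ.StepI.DataNS V) (mk : ℕ) (g : ℕ) (f : ℕ) (qx : ℕ) (Wx : ℕ) : ℕ := kgN (nL κ Φ t p D g f) (ℓL κ Φ t p D g f) (hL κ Φ t p D g f) (vL κ Φ t p D g f) (kgR κ Φ t p D mk) 0 (kgq κ Φ t p D g f qx) (kgW κ Φ t p D g f Wx) (kgTgtR κ Φ t p D mk g f qx)

/-- `tgtR = tgt0 − X1`. [folklore] -/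
theorem kgTgtR_eq (κ : Consts) {V : Type} [DecidableEq V] [Countable V] {G : SimpleGraph V} [G.LocallyFinite] (Φ : PlanarSkeletonFrmFrom G) (t : V) (p : unitInterval) (D : Skelφ.StepI.DataNS V) (mk : ℕ) (g : ℕ) (f : ℕ) (qx : ℕ) : (KS.kgTgtR κ Φ t p D mk g f qx) = (kgTgt0 κ Φ t p D g f mk) - (KS.X1 κ Φ t p D mk g f (kgq κ Φ t p D g f qx)) := rfl

/-- `N_R` unfolded. [folklore] -/
theorem kgNR_eq (κ : Consts) {V : Type} [DecidableEq V] [Countable V] {G : SimpleGraph V} [G.LocallyFinite] (Φ : PlanarSkeletonFrmFrom G) (t : V) (p : unitInterval) (D : Skelφ.StepI.DataNS V) (mk : ℕ) (g : ℕ) (f : ℕ) (qx : ℕ) (Wx : ℕ) : (KS.kgNR κ Φ t p D mk g f qx Wx) = kgN (nL κ Φ t p D g f) (ℓL κ Φ t p D g f) (hL κ Φ t p D g f) (vL κ Φ t p D g f) (kgR κ Φ t p D mk) 0 (kgq κ Φ t p D g f qx) (kgW κ Φ t p D g f Wx) (KS.kgTgtR κ Φ t p D mk g f qx) := rfl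

end Defs

/-! ## §2 The rows -/

section Rows

variable (κ : Consts) {V : Type} [DecidableEq V] [Countable V] {G : SimpleGraph V} [G.LocallyFinite] (Φ : PlanarSkeletonFrmFrom G) (t : V) (p : unitInterval)
  (D : Skelφ.StepI.DataNS V) (mk g f qx Wx : ℕ)

/-- **The landing offset is between `3n_L + R′0 + Rs + 2 + qx` and `4n_L + qx − 2R′0 − Rs − 1`** (`X1 = n_L − R′0 + nB0 + 2n_L + qx`,
`b0 ≤ nB0 ≤ prB0 ≤ fxR0 − Rs − R′0 − 1 ≤ f − … ≤ n_L − …`). [folklore] -/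
theorem X1_bounds (κ : Consts) {V : Type} [DecidableEq V] [Countable V] {G : SimpleGraph V} [G.LocallyFinite] (Φ : PlanarSkeletonFrmFrom G) (t : V) (p : unitInterval) (D : Skelφ.StepI.DataNS V) (mk : ℕ) (g : ℕ) (f : ℕ) (qx : ℕ) (hf : KS.fxR0 κ Φ t p D mk ≤ f) :
    ((KS.Rs t D mk : ℕ) : ℤ) + 3 * (nL κ Φ t p D g f : ℤ) + (KS0.R'0 κ Φ t p D mk) + 2 + qx ≤ (KS.X1 κ Φ t p D mk g f (kgq κ Φ t p D g f qx)) ∧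
      (KS.X1 κ Φ t p D mk g f (kgq κ Φ t p D g f qx)) + 2 * (KS0.R'0 κ Φ t p D mk) + (KS.Rs t D mk : ℕ) + 1 ≤ 4 * (nL κ Φ t p D g f : ℤ) + qx := by
  have e := KS.X1_eq κ Φ t p D mk g f (kgq κ Φ t p D g f qx)
  have hq : (((kgq κ Φ t p D g f qx) : ℕ) : ℤ) = 2 * (nL κ Φ t p D g f : ℤ) + qx := by unfold kgq; push_cast; ring
  have hlo := (KS.RF2_0 κ Φ t p D mk).1
  rw [KS.b0_eq] at hlo
  have hlo' : ((KS.Rs t D mk + 2 * KS0.R'0 κ Φ t p D mk + 2 : ℕ) : ℤ) ≤ (KS.nB0 κ Φ t p D mk : ℤ) := by exact_mod_cast hlo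
  have hhi := (KS.le_prB0 κ Φ t p D mk).1
  have hfn := hf.trans (n₁L_le_nL κ Φ t p D g f).2
  rw [KS.fxR0_eq] at hfn
  have hhi' : ((KS.Rs t D mk + KS0.R'0 κ Φ t p D mk + KS.nB0 κ Φ t p D mk + 1 : ℕ) : ℤ) ≤ (nL κ Φ t p D g f : ℤ) := by
    have : KS.Rs t D mk + KS0.R'0 κ Φ t p D mk + KS.nB0 κ Φ t p D mk + 1 ≤ (nL κ Φ t p D g f) := by omega
    exact_mod_cast this
  push_cast at hlo' hhi'
  constructor <;> linarith

/-- The floors used below, from `EqNumL`, `gFloorKG ≤ g`, `40·K·R′0 ≤ g`: `40K·R′0 + 1 ≤ n_L`, `40K·R′0 ≤ sL + 1`, `958 ≤ sL`, `40 ≤ K`,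
`8R′0 + 7 ≤ n_L`, `|v_L| ≤ n_L`, `1 ≤ n_L`. [folklore] -/
theorem rootRun_floors (κ : Consts) {V : Type} [DecidableEq V] [Countable V] {G : SimpleGraph V} [G.LocallyFinite] (Φ : PlanarSkeletonFrmFrom G) (t : V) (p : unitInterval) (D : Skelφ.StepI.DataNS V) (mk : ℕ) (g : ℕ) (f : ℕ) (hN : EqNumL κ Φ t p D g f) (hg : gFloorKG κ Φ t p D mk ≤ g) (hg2 : 40 * Neg.K κ * KS0.R'0 κ Φ t p D mk ≤ g) :
    40 * (Neg.K κ : ℤ) * (KS0.R'0 κ Φ t p D mk) + 1 ≤ (nL κ Φ t p D g f : ℤ) ∧ 40 * (Neg.K κ : ℤ) * (KS0.R'0 κ Φ t p D mk) ≤ (kgSL (nL κ Φ t p D g f) (ℓL κ Φ t p D g f) (hL κ Φ t p D g f)) + 1 ∧ 958 ≤ (kgSL (nL κ Φ t p D g f) (ℓL κ Φ t p D g f) (hL κ Φ t p D g f)) ∧ (40 : ℤ) ≤ Neg.K κ ∧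
      8 * (((KS0.R'0 κ Φ t p D mk) : ℕ) : ℤ) + 7 ≤ (nL κ Φ t p D g f : ℤ) ∧ |(vL κ Φ t p D g f)| ≤ (nL κ Φ t p D g f : ℤ) ∧ (1 : ℤ) ≤ (nL κ Φ t p D g f : ℤ) := by
  obtain ⟨h1, h2, h3, -, h5, h6⟩ := valsQ_floor κ Φ t p D g f mk hN hg hg2
  have hv := hN.v_le
  have hn1 : (1 : ℤ) ≤ nL κ Φ t p D g f := by exact_mod_cast (one_le_of_eqNumL κ Φ t p D g f hN).1
  exact ⟨by linarith, by linarith, h3, h5, h6, hv, hn1⟩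

/-- **`h0` FOR THE ROOT**: one run step fits below the root's target, `kgFar … 0 ≤ tgtR` (`kgFar … 0 ≤ 363·n_L`, `tgtR ≥ 20K·n_L − 4n_L − qx ≥ 696·n_L`). [this work] -/
theorem kgFar_zero_le_kgTgtR (κ : Consts) {V : Type} [DecidableEq V] [Countable V] {G : SimpleGraph V} [G.LocallyFinite] (Φ : PlanarSkeletonFrmFrom G) (t : V) (p : unitInterval) (D : Skelφ.StepI.DataNS V) (mk : ℕ) (g : ℕ) (f : ℕ) (qx : ℕ) (Wx : ℕ) (hN : EqNumL κ Φ t p D g f) (hg : gFloorKG κ Φ t p D mk ≤ g) (hg2 : 40 * Neg.K κ * KS0.R'0 κ Φ t p D mk ≤ g)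
    (hqx : qx ≤ 100 * nL κ Φ t p D g f) (hWx : (Wx : ℤ) ≤ 20 * (kgSL (nL κ Φ t p D g f) (ℓL κ Φ t p D g f) (hL κ Φ t p D g f))) (hf : KS.fxR0 κ Φ t p D mk ≤ f) :
    (kgFar (nL κ Φ t p D g f) (ℓL κ Φ t p D g f) (hL κ Φ t p D g f) (vL κ Φ t p D g f) (kgR κ Φ t p D mk) 0 (kgq κ Φ t p D g f qx) (kgW κ Φ t p D g f Wx) 0) ≤ (KS.kgTgtR κ Φ t p D mk g f qx) := by
  have H := kgRows0_of κ Φ t p D g f mk qx Wx hN hg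
  obtain ⟨hS, -, hS₂, -, hW2⟩ := kg_floors κ Φ t p D g f mk Wx hN hg hWx
  have hb := H.kgFar_zero_budget hS hS₂ hW2
  obtain ⟨hKR, -, -, hK, h8, hv, hn1⟩ := rootRun_floors κ Φ t p D mk g f hN hg hg2
  obtain ⟨-, hXhi⟩ := X1_bounds κ Φ t p D mk g f qx hf
  have hqx' : ((qx : ℕ) : ℤ) ≤ 100 * (nL κ Φ t p D g f : ℤ) := by exact_mod_cast hqx
  have hpt := (pitch_le_kgTgt0 κ Φ t p D g f mk hN).1
  have hn0 : (0 : ℤ) ≤ (nL κ Φ t p D g f : ℤ) := by linarith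
  have hpitch : 800 * (nL κ Φ t p D g f : ℤ) ≤ pitch κ Φ t p D g f := by unfold pitch; nlinarith
  have e1 : (((kgq κ Φ t p D g f qx) : ℕ) : ℤ) = 2 * (nL κ Φ t p D g f : ℤ) + qx := by unfold kgq; push_cast; ring
  have eR' : (kgR κ Φ t p D mk) = KS0.R'0 κ Φ t p D mk := rfl
  have hRs : (0 : ℤ) ≤ ((KS.Rs t D mk : ℕ) : ℤ) := by positivity
  rw [kgTgtR_eq]
  simp only [eR'] at hb ⊢
  push_cast at hb ⊢
  linarith

/-- **CENTRING FOR THE ROOT**: at `N := N_R` the arrival far edge (measured from `c₁`) lies in `(tgtR − n_L − Δ₀, tgtR]`. [this work] -/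
theorem kgNR_spec (κ : Consts) {V : Type} [DecidableEq V] [Countable V] {G : SimpleGraph V} [G.LocallyFinite] (Φ : PlanarSkeletonFrmFrom G) (t : V) (p : unitInterval) (D : Skelφ.StepI.DataNS V) (mk : ℕ) (g : ℕ) (f : ℕ) (qx : ℕ) (Wx : ℕ) (hN : EqNumL κ Φ t p D g f) (hg : gFloorKG κ Φ t p D mk ≤ g) (hg2 : 40 * Neg.K κ * KS0.R'0 κ Φ t p D mk ≤ g)
    (hqx : qx ≤ 100 * nL κ Φ t p D g f) (hWx : (Wx : ℤ) ≤ 20 * (kgSL (nL κ Φ t p D g f) (ℓL κ Φ t p D g f) (hL κ Φ t p D g f))) (hf : KS.fxR0 κ Φ t p D mk ≤ f) :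
    (kgFar (nL κ Φ t p D g f) (ℓL κ Φ t p D g f) (hL κ Φ t p D g f) (vL κ Φ t p D g f) (kgR κ Φ t p D mk) 0 (kgq κ Φ t p D g f qx) (kgW κ Φ t p D g f Wx) (KS.kgNR κ Φ t p D mk g f qx Wx)) ≤ (KS.kgTgtR κ Φ t p D mk g f qx) ∧
      (KS.kgTgtR κ Φ t p D mk g f qx) < (kgFar (nL κ Φ t p D g f) (ℓL κ Φ t p D g f) (hL κ Φ t p D g f) (vL κ Φ t p D g f) (kgR κ Φ t p D mk) 0 (kgq κ Φ t p D g f qx) (kgW κ Φ t p D g f Wx) (KS.kgNR κ Φ t p D mk g f qx Wx)) + (nL κ Φ t p D g f) + (kgΔ (vL κ Φ t p D g f) (kgR κ Φ t p D mk) 0) := by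
  have H := kgRows0_of κ Φ t p D g f mk qx Wx hN hg
  exact H.kgN_spec (kgFar_zero_le_kgTgtR κ Φ t p D mk g f qx Wx hN hg hg2 hqx hWx hf)

/-- **THE ROOT'S ARRIVAL, MEASURED FROM `t`**: `X1 + kgFar … N_R ∈ (tgt0 − n_L − Δ₀, tgt0]` — the same window as stmt's (C) arrival, so the (C) cube
readings (`arr_bounds`-type rows at `kgTgt0`) apply to the root's arrival box verbatim. [this work] -/
theorem arrR_bounds (κ : Consts) {V : Type} [DecidableEq V] [Countable V] {G : SimpleGraph V} [G.LocallyFinite] (Φ : PlanarSkeletonFrmFrom G) (t : V) (p : unitInterval) (D : Skelφ.StepI.DataNS V) (mk : ℕ) (g : ℕ) (f : ℕ) (qx : ℕ) (Wx : ℕ) (hN : EqNumL κ Φ t p D g f) (hg : gFloorKG κ Φ t p D mk ≤ g) (hg2 : 40 * Neg.K κ * KS0.R'0 κ Φ t p D mk ≤ g)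
    (hqx : qx ≤ 100 * nL κ Φ t p D g f) (hWx : (Wx : ℤ) ≤ 20 * (kgSL (nL κ Φ t p D g f) (ℓL κ Φ t p D g f) (hL κ Φ t p D g f))) (hf : KS.fxR0 κ Φ t p D mk ≤ f) :
    (KS.X1 κ Φ t p D mk g f (kgq κ Φ t p D g f qx)) + (kgFar (nL κ Φ t p D g f) (ℓL κ Φ t p D g f) (hL κ Φ t p D g f) (vL κ Φ t p D g f) (kgR κ Φ t p D mk) 0 (kgq κ Φ t p D g f qx) (kgW κ Φ t p D g f Wx) (KS.kgNR κ Φ t p D mk g f qx Wx)) ≤ (kgTgt0 κ Φ t p D g f mk) ∧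
      (kgTgt0 κ Φ t p D g f mk) < (KS.X1 κ Φ t p D mk g f (kgq κ Φ t p D g f qx)) + (kgFar (nL κ Φ t p D g f) (ℓL κ Φ t p D g f) (hL κ Φ t p D g f) (vL κ Φ t p D g f) (kgR κ Φ t p D mk) 0 (kgq κ Φ t p D g f qx) (kgW κ Φ t p D g f Wx) (KS.kgNR κ Φ t p D mk g f qx Wx)) + (nL κ Φ t p D g f) + (kgΔ (vL κ Φ t p D g f) (kgR κ Φ t p D mk) 0) := by
  obtain ⟨h1, h2⟩ := kgNR_spec κ Φ t p D mk g f qx Wx hN hg hg2 hqx hWx hf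
  rw [kgTgtR_eq] at h1 h2
  constructor <;> linarith

/-- **`N_R + 1 ≤ kgNv0`**: one more run step from `c₁` still fits below stmt's target (`X1 ≥ n_L + Δ₀`), so the root's run is strictly shorter than the
run of record. [this work] -/
theorem kgNR_succ_le_kgNv0 (κ : Consts) {V : Type} [DecidableEq V] [Countable V] {G : SimpleGraph V} [G.LocallyFinite] (Φ : PlanarSkeletonFrmFrom G) (t : V) (p : unitInterval) (D : Skelφ.StepI.DataNS V) (mk : ℕ) (g : ℕ) (f : ℕ) (qx : ℕ) (Wx : ℕ) (hN : EqNumL κ Φ t p D g f) (hg : gFloorKG κ Φ t p D mk ≤ g) (hg2 : 40 * Neg.K κ * KS0.R'0 κ Φ t p D mk ≤ g)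
    (hqx : qx ≤ 100 * nL κ Φ t p D g f) (hWx : (Wx : ℤ) ≤ 20 * (kgSL (nL κ Φ t p D g f) (ℓL κ Φ t p D g f) (hL κ Φ t p D g f))) (hf : KS.fxR0 κ Φ t p D mk ≤ f) :
    (KS.kgNR κ Φ t p D mk g f qx Wx) + 1 ≤ (kgNv0 κ Φ t p D g f mk qx Wx) := by
  have H := kgRows0_of κ Φ t p D g f mk qx Wx hN hg
  obtain ⟨h1, -⟩ := kgNR_spec κ Φ t p D mk g f qx Wx hN hg hg2 hqx hWx hf
  obtain ⟨-, -, -, -, h8, hv, hn1⟩ := rootRun_floors κ Φ t p D mk g f hN hg hg2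
  obtain ⟨hXlo, -⟩ := X1_bounds κ Φ t p D mk g f qx hf
  have hstep := H.kgX_succ_le (KS.kgNR κ Φ t p D mk g f qx Wx)
  have eR' : (kgR κ Φ t p D mk) = KS0.R'0 κ Φ t p D mk := rfl
  have hfit : (kgFar (nL κ Φ t p D g f) (ℓL κ Φ t p D g f) (hL κ Φ t p D g f) (vL κ Φ t p D g f) (kgR κ Φ t p D mk) 0 (kgq κ Φ t p D g f qx) (kgW κ Φ t p D g f Wx) ((KS.kgNR κ Φ t p D mk g f qx Wx) + 1)) ≤ (kgTgt0 κ Φ t p D g f mk) := by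
    rw [kgTgtR_eq] at h1
    unfold kgFar at h1 ⊢
    unfold kgΔ at hstep
    simp only [eR'] at h1 hstep ⊢
    push_cast at h1 hstep ⊢
    have hRs : (0 : ℤ) ≤ ((KS.Rs t D mk : ℕ) : ℤ) := by positivity
    have hqx0 : (0 : ℤ) ≤ ((qx : ℕ) : ℤ) := by positivity
    nlinarith
  exact H.le_kgN hfit

/-- `N_R ≤ kgNv0`. [folklore] -/
theorem kgNR_le_kgNv0 (κ : Consts) {V : Type} [DecidableEq V] [Countable V] {G : SimpleGraph V} [G.LocallyFinite] (Φ : PlanarSkeletonFrmFrom G) (t : V) (p : unitInterval) (D : Skelφ.StepI.DataNS V) (mk : ℕ) (g : ℕ) (f : ℕ) (qx : ℕ) (Wx : ℕ) (hN : EqNumL κ Φ t p D g f) (hg : gFloorKG κ Φ t p D mk ≤ g) (hg2 : 40 * Neg.K κ * KS0.R'0 κ Φ t p D mk ≤ g)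
    (hqx : qx ≤ 100 * nL κ Φ t p D g f) (hWx : (Wx : ℤ) ≤ 20 * (kgSL (nL κ Φ t p D g f) (ℓL κ Φ t p D g f) (hL κ Φ t p D g f))) (hf : KS.fxR0 κ Φ t p D mk ≤ f) :
    (KS.kgNR κ Φ t p D mk g f qx Wx) ≤ (kgNv0 κ Φ t p D g f mk qx Wx) :=
  (Nat.le_succ _).trans (kgNR_succ_le_kgNv0 κ Φ t p D mk g f qx Wx hN hg hg2 hqx hWx hf)

/-- **`m₁(N_R) + 1 ≤ 66`** (generic window: `2sL(m₁+1) ≤ 6W + 6(N_R+1)R′ ≤ 126sL + 3(sL+1) + 24R′ < 134sL`). [this work] -/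
theorem kgM₁R_le (κ : Consts) {V : Type} [DecidableEq V] [Countable V] {G : SimpleGraph V} [G.LocallyFinite] (Φ : PlanarSkeletonFrmFrom G) (t : V) (p : unitInterval) (D : Skelφ.StepI.DataNS V) (mk : ℕ) (g : ℕ) (f : ℕ) (qx : ℕ) (Wx : ℕ) (hN : EqNumL κ Φ t p D g f) (hg : gFloorKG κ Φ t p D mk ≤ g) (hg2 : 40 * Neg.K κ * KS0.R'0 κ Φ t p D mk ≤ g)
    (hqx : qx ≤ 100 * nL κ Φ t p D g f) (hWx : (Wx : ℤ) ≤ 20 * (kgSL (nL κ Φ t p D g f) (ℓL κ Φ t p D g f) (hL κ Φ t p D g f))) (hf : KS.fxR0 κ Φ t p D mk ≤ f) :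
    (((kgM₁ (nL κ Φ t p D g f) (ℓL κ Φ t p D g f) (hL κ Φ t p D g f) (kgR κ Φ t p D mk) 0 (kgW κ Φ t p D g f Wx) (KS.kgNR κ Φ t p D mk g f qx Wx)) : ℕ) : ℤ) + 1 ≤ 66 := by
  have H := kgRows0_of κ Φ t p D g f mk qx Wx hN hg
  obtain ⟨hS, -, -, hR8, hW2⟩ := kg_floors κ Φ t p D g f mk Wx hN hg hWx
  obtain ⟨-, hKs, h958, hK, -, -, -⟩ := rootRun_floors κ Φ t p D mk g f hN hg hg2
  have hb := H.kgM₁_budget hS (KS.kgNR κ Φ t p D mk g f qx Wx)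
  have hNle : (((KS.kgNR κ Φ t p D mk g f qx Wx) : ℕ) : ℤ) + 1 ≤ 20 * (Neg.K κ : ℤ) + 4 := by
    have := kgNR_succ_le_kgNv0 κ Φ t p D mk g f qx Wx hN hg hg2 hqx hWx hf
    have h2 := kgNv0_le κ Φ t p D g f mk qx Wx hN hg
    have : (KS.kgNR κ Φ t p D mk g f qx Wx) + 1 ≤ 20 * Neg.K κ + 4 := this.trans h2
    exact_mod_cast this
  have eR' : (kgR κ Φ t p D mk) = KS0.R'0 κ Φ t p D mk := rfl
  unfold kgT₁ at hb
  simp only [eR'] at hb hS hR8 ⊢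
  set a := (((kgM₁ (nL κ Φ t p D g f) (ℓL κ Φ t p D g f) (hL κ Φ t p D g f) (KS0.R'0 κ Φ t p D mk) 0 (kgW κ Φ t p D g f Wx) (KS.kgNR κ Φ t p D mk g f qx Wx)) : ℕ) : ℤ) + 1 with ha
  set s := (kgSL (nL κ Φ t p D g f) (ℓL κ Φ t p D g f) (hL κ Φ t p D g f)) with hs
  set r := (((KS0.R'0 κ Φ t p D mk) : ℕ) : ℤ) with hr
  have ha0 : 0 ≤ a := by positivity
  have hr0 : 0 ≤ r := by positivity
  have hN0 : (0 : ℤ) ≤ (((KS.kgNR κ Φ t p D mk g f qx Wx) : ℕ) : ℤ) := by positivity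
  -- (N_R+1)·r ≤ (20K+4)·r ≤ (s+1)/2 + 4r
  have h1 : ((((KS.kgNR κ Φ t p D mk g f qx Wx) : ℕ) : ℤ) + 1) * r ≤ (20 * (Neg.K κ : ℤ) + 4) * r := mul_le_mul_of_nonneg_right hNle hr0
  have h2 : 2 * ((20 * (Neg.K κ : ℤ) + 4) * r) ≤ s + 1 + 8 * r := by nlinarith
  have h3 : 2 * s * a ≤ 132 * s + 3 + 0 := by nlinarith
  have h4 : 2 * s * a < 2 * s * 67 := by linarith
  have := lt_of_mul_lt_mul_left h4 (by linarith)
  linarith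

/-- **`X₂(N_R) ≤ 178·n_L`** (`q ≤ 102n_L`, `(N_R+1)R′ ≤ (n_L − 1)/2 + 4R′`, `(m₁+1)(R′+|v|) ≤ 66(R′ + n_L)`, `8R′ + 7 ≤ n_L`). [this work] -/
theorem kgX₂R_le (κ : Consts) {V : Type} [DecidableEq V] [Countable V] {G : SimpleGraph V} [G.LocallyFinite] (Φ : PlanarSkeletonFrmFrom G) (t : V) (p : unitInterval) (D : Skelφ.StepI.DataNS V) (mk : ℕ) (g : ℕ) (f : ℕ) (qx : ℕ) (Wx : ℕ) (hN : EqNumL κ Φ t p D g f) (hg : gFloorKG κ Φ t p D mk ≤ g) (hg2 : 40 * Neg.K κ * KS0.R'0 κ Φ t p D mk ≤ g)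
    (hqx : qx ≤ 100 * nL κ Φ t p D g f) (hWx : (Wx : ℤ) ≤ 20 * (kgSL (nL κ Φ t p D g f) (ℓL κ Φ t p D g f) (hL κ Φ t p D g f))) (hf : KS.fxR0 κ Φ t p D mk ≤ f) :
    (kgX₂ (nL κ Φ t p D g f) (ℓL κ Φ t p D g f) (hL κ Φ t p D g f) (vL κ Φ t p D g f) (kgR κ Φ t p D mk) 0 (kgq κ Φ t p D g f qx) (kgW κ Φ t p D g f Wx) (KS.kgNR κ Φ t p D mk g f qx Wx)) ≤ 178 * (nL κ Φ t p D g f : ℤ) := by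
  have ha := kgM₁R_le κ Φ t p D mk g f qx Wx hN hg hg2 hqx hWx hf
  obtain ⟨hKR, -, -, hK, h8, hv, hn1⟩ := rootRun_floors κ Φ t p D mk g f hN hg hg2
  have hNle : (((KS.kgNR κ Φ t p D mk g f qx Wx) : ℕ) : ℤ) + 1 ≤ 20 * (Neg.K κ : ℤ) + 4 := by
    have := kgNR_succ_le_kgNv0 κ Φ t p D mk g f qx Wx hN hg hg2 hqx hWx hf
    have h2 := kgNv0_le κ Φ t p D g f mk qx Wx hN hg
    have : (KS.kgNR κ Φ t p D mk g f qx Wx) + 1 ≤ 20 * Neg.K κ + 4 := this.trans h2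
    exact_mod_cast this
  have hqx' : ((qx : ℕ) : ℤ) ≤ 100 * (nL κ Φ t p D g f : ℤ) := by exact_mod_cast hqx
  have e1 : (((kgq κ Φ t p D g f qx) : ℕ) : ℤ) = 2 * (nL κ Φ t p D g f : ℤ) + qx := by unfold kgq; push_cast; ring
  have eR' : (kgR κ Φ t p D mk) = KS0.R'0 κ Φ t p D mk := rfl
  unfold kgX₂
  simp only [eR'] at ha ⊢
  set a := (((kgM₁ (nL κ Φ t p D g f) (ℓL κ Φ t p D g f) (hL κ Φ t p D g f) (KS0.R'0 κ Φ t p D mk) 0 (kgW κ Φ t p D g f Wx) (KS.kgNR κ Φ t p D mk g f qx Wx)) : ℕ) : ℤ) + 1 with ha'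
  set r := (((KS0.R'0 κ Φ t p D mk) : ℕ) : ℤ) with hr
  have ha0 : 0 ≤ a := by positivity
  have hr0 : 0 ≤ r := by positivity
  have hva : (0 : ℤ) ≤ |(vL κ Φ t p D g f)| := abs_nonneg _
  have hN0 : (0 : ℤ) ≤ (((KS.kgNR κ Φ t p D mk g f qx Wx) : ℕ) : ℤ) := by positivity
  have h1 : ((((KS.kgNR κ Φ t p D mk g f qx Wx) : ℕ) : ℤ) + 1) * r ≤ (20 * (Neg.K κ : ℤ) + 4) * r := mul_le_mul_of_nonneg_right hNle hr0
  have h2 : 2 * ((20 * (Neg.K κ : ℤ) + 4) * r) ≤ (nL κ Φ t p D g f : ℤ) - 1 + 8 * r := by nlinarith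
  have h3 : a * (r + ((0 : ℕ) : ℤ) + |(vL κ Φ t p D g f)|) ≤ 66 * r + 66 * (nL κ Φ t p D g f : ℤ) := by push_cast; nlinarith
  push_cast at h3 ⊢
  nlinarith

/-- **THE ROOT'S RUN IS LONG**: `20K ≤ N_R + 463`, hence `N_R + 1 ≥ 20K − 462 ≥ 338`. [this work] -/
theorem kgNR_lb (κ : Consts) {V : Type} [DecidableEq V] [Countable V] {G : SimpleGraph V} [G.LocallyFinite] (Φ : PlanarSkeletonFrmFrom G) (t : V) (p : unitInterval) (D : Skelφ.StepI.DataNS V) (mk : ℕ) (g : ℕ) (f : ℕ) (qx : ℕ) (Wx : ℕ) (hN : EqNumL κ Φ t p D g f) (hg : gFloorKG κ Φ t p D mk ≤ g) (hg2 : 40 * Neg.K κ * KS0.R'0 κ Φ t p D mk ≤ g)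
    (hqx : qx ≤ 100 * nL κ Φ t p D g f) (hWx : (Wx : ℤ) ≤ 20 * (kgSL (nL κ Φ t p D g f) (ℓL κ Φ t p D g f) (hL κ Φ t p D g f))) (hf : KS.fxR0 κ Φ t p D mk ≤ f) :
    20 * (Neg.K κ : ℤ) ≤ (((KS.kgNR κ Φ t p D mk g f qx Wx) : ℕ) : ℤ) + 1 + 462 := by
  have H := kgRows0_of κ Φ t p D g f mk qx Wx hN hg
  obtain ⟨-, h2⟩ := kgNR_spec κ Φ t p D mk g f qx Wx hN hg hg2 hqx hWx hf
  obtain ⟨-, -, hS₂, -, -⟩ := kg_floors κ Φ t p D g f mk Wx hN hg hWx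
  have hfar := H.kgFar_budget hS₂ (KS.kgNR κ Φ t p D mk g f qx Wx)
  have ha := kgM₁R_le κ Φ t p D mk g f qx Wx hN hg hg2 hqx hWx hf
  obtain ⟨hKR, -, -, hK, h8, hv, hn1⟩ := rootRun_floors κ Φ t p D mk g f hN hg hg2
  obtain ⟨-, hXhi⟩ := X1_bounds κ Φ t p D mk g f qx hf
  have hNle : (((KS.kgNR κ Φ t p D mk g f qx Wx) : ℕ) : ℤ) + 1 ≤ 20 * (Neg.K κ : ℤ) + 4 := by
    have := kgNR_succ_le_kgNv0 κ Φ t p D mk g f qx Wx hN hg hg2 hqx hWx hf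
    have h2 := kgNv0_le κ Φ t p D g f mk qx Wx hN hg
    have : (KS.kgNR κ Φ t p D mk g f qx Wx) + 1 ≤ 20 * Neg.K κ + 4 := this.trans h2
    exact_mod_cast this
  have hqx' : ((qx : ℕ) : ℤ) ≤ 100 * (nL κ Φ t p D g f : ℤ) := by exact_mod_cast hqx
  have e1 : (((kgq κ Φ t p D g f qx) : ℕ) : ℤ) = 2 * (nL κ Φ t p D g f : ℤ) + qx := by unfold kgq; push_cast; ring
  have hpt := (pitch_le_kgTgt0 κ Φ t p D g f mk hN).1
  have epitch : pitch κ Φ t p D g f = 20 * (Neg.K κ : ℤ) * (nL κ Φ t p D g f : ℤ) := rfl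
  have eR' : (kgR κ Φ t p D mk) = KS0.R'0 κ Φ t p D mk := rfl
  rw [kgTgtR_eq] at h2
  unfold kgΔ at h2
  simp only [eR'] at h2 hfar ha ⊢
  have hM0 : (0 : ℤ) ≤ (((KS.kgNR κ Φ t p D mk g f qx Wx) : ℕ) : ℤ) := by positivity
  have hr0 : (0 : ℤ) ≤ (((KS0.R'0 κ Φ t p D mk) : ℕ) : ℤ) := by positivity
  have hva : (0 : ℤ) ≤ |(vL κ Φ t p D g f)| := abs_nonneg _
  have ha0 : (0 : ℤ) ≤ (((kgM₁ (nL κ Φ t p D g f) (ℓL κ Φ t p D g f) (hL κ Φ t p D g f) (KS0.R'0 κ Φ t p D mk) 0 (kgW κ Φ t p D g f Wx) (KS.kgNR κ Φ t p D mk g f qx Wx)) : ℕ) : ℤ) + 1 := by positivity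
  have hRs : (0 : ℤ) ≤ ((KS.Rs t D mk : ℕ) : ℤ) := by positivity
  have h1 : ((((KS.kgNR κ Φ t p D mk g f qx Wx) : ℕ) : ℤ) + 1) * (((KS0.R'0 κ Φ t p D mk) : ℕ) : ℤ) ≤ (20 * (Neg.K κ : ℤ) + 4) * (((KS0.R'0 κ Φ t p D mk) : ℕ) : ℤ) :=
    mul_le_mul_of_nonneg_right hNle hr0
  have h2' : 2 * ((20 * (Neg.K κ : ℤ) + 4) * (((KS0.R'0 κ Φ t p D mk) : ℕ) : ℤ)) ≤ (nL κ Φ t p D g f : ℤ) - 1 + 8 * (((KS0.R'0 κ Φ t p D mk) : ℕ) : ℤ) := by linarith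
  have h3 : ((((kgM₁ (nL κ Φ t p D g f) (ℓL κ Φ t p D g f) (hL κ Φ t p D g f) (KS0.R'0 κ Φ t p D mk) 0 (kgW κ Φ t p D g f Wx) (KS.kgNR κ Φ t p D mk g f qx Wx)) : ℕ) : ℤ) + 1) * ((((KS0.R'0 κ Φ t p D mk) : ℕ) : ℤ) + ((0 : ℕ) : ℤ) + |(vL κ Φ t p D g f)|) ≤
      66 * (((KS0.R'0 κ Φ t p D mk) : ℕ) : ℤ) + 66 * (nL κ Φ t p D g f : ℤ) := by
    push_cast; nlinarith
  push_cast at hfar h2 h3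
  -- far(N_R) ≤ (N_R+1)·n + 355·n and tgtR ≥ 20K·n − 4n − qx
  have hfar' : (kgFar (nL κ Φ t p D g f) (ℓL κ Φ t p D g f) (hL κ Φ t p D g f) (vL κ Φ t p D g f) (KS0.R'0 κ Φ t p D mk) 0 (kgq κ Φ t p D g f qx) (kgW κ Φ t p D g f Wx) (KS.kgNR κ Φ t p D mk g f qx Wx)) ≤ ((((KS.kgNR κ Φ t p D mk g f qx Wx) : ℕ) : ℤ) + 1) * (nL κ Φ t p D g f : ℤ) + 355 * (nL κ Φ t p D g f : ℤ) := by linarith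
  by_contra hcon
  have hlt : (((KS.kgNR κ Φ t p D mk g f qx Wx) : ℕ) : ℤ) + 1 + 462 + 1 ≤ 20 * (Neg.K κ : ℤ) := by linarith [not_le.mp hcon]
  have hmul : (((((KS.kgNR κ Φ t p D mk g f qx Wx) : ℕ) : ℤ)) + 1 + 462 + 1) * (nL κ Φ t p D g f : ℤ) ≤ 20 * (Neg.K κ : ℤ) * (nL κ Φ t p D g f : ℤ) :=
    mul_le_mul_of_nonneg_right hlt (by linarith)
  linarith

/-- **THE SKELETON'S `hnR ∧ hrow` AT THE ROOT'S RUN LENGTH** (`SkelFrm1RootHoldsQCKT.rootLegAt_frmQ3KT_fst`, `HK := kgRows0_of … mk qx Wx`, `N := N_R`):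
`R′0 ≤ n_L` and `q + (N_R+1)·R′0 + (m₁(N_R)+1)·(R′0 + 0 + |v_L|) + n_L ≤ (N_R+1)·n_L` (left side `= X₂(N_R) + n_L ≤ 179·n_L`, right side `≥ 338·n_L`).
[this work] -/
theorem hrowR (κ : Consts) {V : Type} [DecidableEq V] [Countable V] {G : SimpleGraph V} [G.LocallyFinite] (Φ : PlanarSkeletonFrmFrom G) (t : V) (p : unitInterval) (D : Skelφ.StepI.DataNS V) (mk : ℕ) (g : ℕ) (f : ℕ) (qx : ℕ) (Wx : ℕ) (hN : EqNumL κ Φ t p D g f) (hg : gFloorKG κ Φ t p D mk ≤ g) (hg2 : 40 * Neg.K κ * KS0.R'0 κ Φ t p D mk ≤ g)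
    (hqx : qx ≤ 100 * nL κ Φ t p D g f) (hWx : (Wx : ℤ) ≤ 20 * (kgSL (nL κ Φ t p D g f) (ℓL κ Φ t p D g f) (hL κ Φ t p D g f))) (hf : KS.fxR0 κ Φ t p D mk ≤ f) :
    KS0.R'0 κ Φ t p D mk ≤ (nL κ Φ t p D g f) ∧
    (((kgq κ Φ t p D g f qx) : ℕ) : ℤ) + ((((KS.kgNR κ Φ t p D mk g f qx Wx) : ℕ) : ℤ) + 1) * (((KS0.R'0 κ Φ t p D mk) : ℕ) : ℤ) +
        (((((kgM₁ (nL κ Φ t p D g f) (ℓL κ Φ t p D g f) (hL κ Φ t p D g f) (KS0.R'0 κ Φ t p D mk) 0 (kgW κ Φ t p D g f Wx) (KS.kgNR κ Φ t p D mk g f qx Wx)) : ℕ) : ℤ)) + 1) * ((((KS0.R'0 κ Φ t p D mk) : ℕ) : ℤ) + ((0 : ℕ) : ℤ) + |(vL κ Φ t p D g f)|) + (nL κ Φ t p D g f : ℤ) ≤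
      ((((KS.kgNR κ Φ t p D mk g f qx Wx) : ℕ) : ℤ) + 1) * (nL κ Φ t p D g f : ℤ) := by
  have hX := kgX₂R_le κ Φ t p D mk g f qx Wx hN hg hg2 hqx hWx hf
  have hlb := kgNR_lb κ Φ t p D mk g f qx Wx hN hg hg2 hqx hWx hf
  obtain ⟨-, -, -, hK, h8, -, hn1⟩ := rootRun_floors κ Φ t p D mk g f hN hg hg2
  have eR' : (kgR κ Φ t p D mk) = KS0.R'0 κ Φ t p D mk := rfl
  have eX₂ : (kgX₂ (nL κ Φ t p D g f) (ℓL κ Φ t p D g f) (hL κ Φ t p D g f) (vL κ Φ t p D g f) (kgR κ Φ t p D mk) 0 (kgq κ Φ t p D g f qx) (kgW κ Φ t p D g f Wx) (KS.kgNR κ Φ t p D mk g f qx Wx)) = (((kgq κ Φ t p D g f qx) : ℕ) : ℤ) + ((((KS.kgNR κ Φ t p D mk g f qx Wx) : ℕ) : ℤ) + 1) * (((KS0.R'0 κ Φ t p D mk) : ℕ) : ℤ) +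
      (((((kgM₁ (nL κ Φ t p D g f) (ℓL κ Φ t p D g f) (hL κ Φ t p D g f) (KS0.R'0 κ Φ t p D mk) 0 (kgW κ Φ t p D g f Wx) (KS.kgNR κ Φ t p D mk g f qx Wx)) : ℕ) : ℤ)) + 1) * ((((KS0.R'0 κ Φ t p D mk) : ℕ) : ℤ) + ((0 : ℕ) : ℤ) + |(vL κ Φ t p D g f)|) := rfl
  constructor
  · have h0 : (0 : ℤ) ≤ (((KS0.R'0 κ Φ t p D mk) : ℕ) : ℤ) := by positivity
    have : (((KS0.R'0 κ Φ t p D mk) : ℕ) : ℤ) ≤ (nL κ Φ t p D g f : ℤ) := by linarith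
    exact_mod_cast this
  · rw [← eX₂]
    have hM0 : (0 : ℤ) ≤ (((KS.kgNR κ Φ t p D mk g f qx Wx) : ℕ) : ℤ) := by positivity
    have hn0 : (0 : ℤ) ≤ (nL κ Φ t p D g f : ℤ) := by positivity
    have h338 : (338 : ℤ) ≤ (((KS.kgNR κ Φ t p D mk g f qx Wx) : ℕ) : ℤ) + 1 := by linarith
    have hmul := mul_le_mul_of_nonneg_right h338 hn0
    linarith

/-- **THE ROOT'S LENGTH ROW** (`hlen` with `bridgeFrame_N = 0`): `N_R + 1 + (m₁(N_R)+1) + (m₂(N_R)+1) ≤ LfQ κ.K₀`, at the residual floors of record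
`KGRes` (by N-monotonicity of the schedule length and stmt's `kgSchedN_le_LfQ`). [this work] -/
theorem kgSchedNR_le_LfQ (κ : Consts) {V : Type} [DecidableEq V] [Countable V] {G : SimpleGraph V} [G.LocallyFinite] (Φ : PlanarSkeletonFrmFrom G) (t : V) (p : unitInterval) (D : Skelφ.StepI.DataNS V) (mk : ℕ) (g : ℕ) (f : ℕ) (qx : ℕ) (Wx : ℕ) (hN : EqNumL κ Φ t p D g f) (hg : gFloorKG κ Φ t p D mk ≤ g) (hg2 : 40 * Neg.K κ * KS0.R'0 κ Φ t p D mk ≤ g)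
    (hqx : qx ≤ 100 * nL κ Φ t p D g f) (hWx : (Wx : ℤ) ≤ 20 * (kgSL (nL κ Φ t p D g f) (ℓL κ Φ t p D g f) (hL κ Φ t p D g f))) (hf : KS.fxR0 κ Φ t p D mk ≤ f)
    (hx : KGRes κ Φ t p D g f qx Wx) :
    (KS.kgNR κ Φ t p D mk g f qx Wx) + 1 + ((kgM₁ (nL κ Φ t p D g f) (ℓL κ Φ t p D g f) (hL κ Φ t p D g f) (kgR κ Φ t p D mk) 0 (kgW κ Φ t p D g f Wx) (KS.kgNR κ Φ t p D mk g f qx Wx)) + 1) + ((kgM₂ (nL κ Φ t p D g f) (ℓL κ Φ t p D g f) (hL κ Φ t p D g f) (vL κ Φ t p D g f) (kgR κ Φ t p D mk) 0 (kgq κ Φ t p D g f qx) (kgW κ Φ t p D g f Wx) (KS.kgNR κ Φ t p D mk g f qx Wx)) + 1) ≤ LfQ κ.K₀ := by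
  have H := kgRows0_of κ Φ t p D g f mk qx Wx hN hg
  exact (H.kgSchedLen_mono (kgNR_le_kgNv0 κ Φ t p D mk g f qx Wx hN hg hg2 hqx hWx hf)).trans (kgSchedN_le_LfQ κ Φ t p D g f mk qx Wx hN hg hx)

/-- **THE DEPTH ROW'S N-DEPENDENT PART, TRANSFERRED**: `(N_R+1)·n_L + Z₀(N_R) ≤ (kgNv0+1)·n_L + Z₀(kgNv0)` and
`Z₁(N_R) ≤ 7P + W + sL + (kgNv0+1)R′ + (m₁(kgNv0) + m₂(kgNv0) + 2)·R′` — so stmt's `Z₀Q_le`/`Z₁Q_le`-type numerals at `kgNv0` bound the root's reach.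
[this work] -/
theorem reachR_le (κ : Consts) {V : Type} [DecidableEq V] [Countable V] {G : SimpleGraph V} [G.LocallyFinite] (Φ : PlanarSkeletonFrmFrom G) (t : V) (p : unitInterval) (D : Skelφ.StepI.DataNS V) (mk : ℕ) (g : ℕ) (f : ℕ) (qx : ℕ) (Wx : ℕ) (hN : EqNumL κ Φ t p D g f) (hg : gFloorKG κ Φ t p D mk ≤ g) (hg2 : 40 * Neg.K κ * KS0.R'0 κ Φ t p D mk ≤ g)
    (hqx : qx ≤ 100 * nL κ Φ t p D g f) (hWx : (Wx : ℤ) ≤ 20 * (kgSL (nL κ Φ t p D g f) (ℓL κ Φ t p D g f) (hL κ Φ t p D g f))) (hf : KS.fxR0 κ Φ t p D mk ≤ f) :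
    ((((KS.kgNR κ Φ t p D mk g f qx Wx) : ℕ) : ℤ) + 1) * (nL κ Φ t p D g f : ℤ) + (kgZ₀ (nL κ Φ t p D g f) (vL κ Φ t p D g f) (kgR κ Φ t p D mk) 0 (kgq κ Φ t p D g f qx) (KS.kgNR κ Φ t p D mk g f qx Wx) (kgM₁ (nL κ Φ t p D g f) (ℓL κ Φ t p D g f) (hL κ Φ t p D g f) (kgR κ Φ t p D mk) 0 (kgW κ Φ t p D g f Wx) (KS.kgNR κ Φ t p D mk g f qx Wx)) (kgM₂ (nL κ Φ t p D g f) (ℓL κ Φ t p D g f) (hL κ Φ t p D g f) (vL κ Φ t p D g f) (kgR κ Φ t p D mk) 0 (kgq κ Φ t p D g f qx) (kgW κ Φ t p D g f Wx) (KS.kgNR κ Φ t p D mk g f qx Wx))) ≤ ((((kgNv0 κ Φ t p D g f mk qx Wx) : ℕ) : ℤ) + 1) * (nL κ Φ t p D g f : ℤ) + (kgZ₀ (nL κ Φ t p D g f) (vL κ Φ t p D g f) (kgR κ Φ t p D mk) 0 (kgq κ Φ t p D g f qx) (kgNv0 κ Φ t p D g f mk qx Wx) (kgM₁ (nL κ Φ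 t p D g f) (ℓL κ Φ t p D g f) (hL κ Φ t p D g f) (kgR κ Φ t p D mk) 0 (kgW κ Φ t p D g f Wx) (kgNv0 κ Φ t p D g f mk qx Wx)) (kgM₂ (nL κ Φ t p D g f) (ℓL κ Φ t p D g f) (hL κ Φ t p D g f) (vL κ Φ t p D g f) (kgR κ Φ t p D mk) 0 (kgq κ Φ t p D g f qx) (kgW κ Φ t p D g f Wx) (kgNv0 κ Φ t p D g f mk qx Wx))) ∧
    (kgZ₁ (nL κ Φ t p D g f) (ℓL κ Φ t p D g f) (hL κ Φ t p D g f) (kgR κ Φ t p D mk) 0 (kgW κ Φ t p D g f Wx) (KS.kgNR κ Φ t p D mk g f qx Wx) (kgM₁ (nL κ Φ t p D g f) (ℓL κ Φ t p D g f) (hL κ Φ t p D g f) (kgR κ Φ t p D mk) 0 (kgW κ Φ t p D g f Wx) (KS.kgNR κ Φ t p D mk g f qx Wx)) (kgWm₂ (nL κ Φ t p D g f) (ℓL κ Φ t p D g f) (hL κ Φ t p D g f) (kgR κ Φ t p D mk) 0 (kgW κ Φ t p D g f Wx) (KS.kgNR κ Φ t p D mk g f qx Wx)) (kgWp₂ (nL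 κ Φ t p D g f) (ℓL κ Φ t p D g f) (hL κ Φ t p D g f) (kgR κ Φ t p D mk) 0 (kgW κ Φ t p D g f Wx) (KS.kgNR κ Φ t p D mk g f qx Wx)) (kgM₂ (nL κ Φ t p D g f) (ℓL κ Φ t p D g f) (hL κ Φ t p D g f) (vL κ Φ t p D g f) (kgR κ Φ t p D mk) 0 (kgq κ Φ t p D g f qx) (kgW κ Φ t p D g f Wx) (KS.kgNR κ Φ t p D mk g f qx Wx))) ≤
      7 * (((nL κ Φ t p D g f) * (ℓL κ Φ t p D g f) / shearUnit (nL κ Φ t p D g f) (hL κ Φ t p D g f) + 1 : ℕ) : ℤ) + (kgW κ Φ t p D g f Wx) + (kgSL (nL κ Φ t p D g f) (ℓL κ Φ t p D g f) (hL κ Φ t p D g f)) + ((((kgNv0 κ Φ t p D g f mk qx Wx) : ℕ) : ℤ) + 1) * (kgR κ Φ t p D mk) +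
        (((((kgM₁ (nL κ Φ t p D g f) (ℓL κ Φ t p D g f) (hL κ Φ t p D g f) (kgR κ Φ t p D mk) 0 (kgW κ Φ t p D g f Wx) (kgNv0 κ Φ t p D g f mk qx Wx)) : ℕ) : ℤ)) + ((kgM₂ (nL κ Φ t p D g f) (ℓL κ Φ t p D g f) (hL κ Φ t p D g f) (vL κ Φ t p D g f) (kgR κ Φ t p D mk) 0 (kgq κ Φ t p D g f qx) (kgW κ Φ t p D g f Wx) (kgNv0 κ Φ t p D g f mk qx Wx)) : ℕ) + 2) * ((((kgR κ Φ t p D mk) : ℕ) : ℤ) + ((0 : ℕ) : ℤ)) := by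
  have H := kgRows0_of κ Φ t p D g f mk qx Wx hN hg
  have hle := kgNR_le_kgNv0 κ Φ t p D mk g f qx Wx hN hg hg2 hqx hWx hf
  have hZ₀ := H.kgZ₀_mono hle
  have hZ₁ := H.kgZ₁_le_of_le hle
  have hn0 : (0 : ℤ) ≤ (nL κ Φ t p D g f : ℤ) := by positivity
  have hle' : (((KS.kgNR κ Φ t p D mk g f qx Wx) : ℕ) : ℤ) ≤ (((kgNv0 κ Φ t p D g f mk qx Wx) : ℕ) : ℤ) := by exact_mod_cast hle
  refine ⟨by nlinarith, hZ₁⟩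

end Rows

end KS

end NegB

end PlanarSkeletonFrmFrom

end Summit.CriticalPhenomena.PercolationContinuityZ3.Theorems.Transplant

end
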